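import Literature.Algebra.Polynomial.CasasAlvero.Char239Digits
import Literature.Algebra.Polynomial.CasasAlvero.Char239DigitsHigh
import Literature.Algebra.Polynomial.CasasAlvero.Degree7Char239
import Literature.Algebra.Polynomial.CasasAlvero.Pentanomial
import Literature.Algebra.Polynomial.CasasAlvero.Degree6CandidatesPrime
import Literature.Algebra.Polynomial.CasasAlvero.FieldCorollaries
import Literature.Algebra.Polynomial.CasasAlvero.Degree5
import Literature.Algebra.Polynomial.CasasAlvero.Degree6
import Literature.Algebra.Polynomial.CasasAlvero.DigitReduction
import HarnessLib

/-!
# Casas-Alvero degrees in characteristic 239: the complete classification (seven good digits)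

Over EVERY field `K` of characteristic `239`: `CA_d(K) ⟺ d = 0 ∨ d = a·239^k` with `1 ≤ a ≤ 7` — like `127`, a prime with SEVEN good digits.
Ingredients: the digit reduction `CA_d ⇒ d = a·p^k ∧ CA_a` (`DigitReduction.lean`, any field); the positive digits `1, 2, 3, 4`
([GrafVonBothmerEtAl2007, Props. 2, 6]), `5` (`Degree5.lean`: `239` is not one of the nine bad primes of degree `5`), `6` (`239` is not among the `54`
candidate bad primes of degree `6` of `Degree6CandidatesPrime.lean`, so `CA_6` holds in characteristic `239` [CastryckLaterveerOunaies2012, Thm. 4]) and `7`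
(`Degree7Char239.lean`: `239` is a GOOD prime for degree `7` — the kernel-checked scenario certificates `holdsInDegree_seven_of_char_239`; the bad primes of
degree `7` were computed in [CastryckLaterveerOunaies2012, Thm. 4] — with `CA_{7·239^k}` descending from the algebraic closure); and a refutation of every
digit `8 ≤ a ≤ 238` over every field of characteristic `239`:
`25, 62, 66, 77, 78, 79, 84, 86, 91, 92, 93, 94, 98, 99, 100, 102, 106, 111, 115, 117, 120, 122, 127, 129, 133, 137, 146, 148, 150, 155, 156, 158, 159, 160, 168, 169, 172, 174, 178, 179, 180, 185, 186, 187, 191, 193, 195, 196, 201, 206, 209, 210, 212, 215, 217, 219, 222, 229, 232, 233, 236, 238` by the binomial criterion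
(`m = 6, 25, 5, 37, 26, 10, 19, 11, 29, 27, 46, 42, 28, 20, 25, 23, 49, 5, 53, 12, 51, 58, 18, 18, 12, 51, 64, 60, 7, 59, 64, 78, 20, 75, 21, 10, 85, 58, 88, 83, 64, 62, 26, 86, 46, 43, 45, 52, 40, 52, 62, 70, 52, 9, 96, 6, 53, 23, 53, 106, 71, 2`); and the 169 remaining digits by the sparse `𝔽_239`-examples of `Char239Digits.lean` and `Char239DigitsHigh.lean`.
-/

noncomputable section

open Polynomial

set_option maxRecDepth 8192

namespace Literature.Algebra.Polynomial.CasasAlvero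

section CharTwoHundredThirtyNine

variable (K : Type*) [Field K] [CharP K 239]

/-- `CA_{6·239^k}` over every field of characteristic `239` (`CA_6` itself — the case `k = 0` — holds because `239` is not among the
`54` candidate bad primes of degree `6` of `Degree6CandidatesPrime.lean`, `holdsInDegree_six_of_not_mem`, i.e. `239` is a GOOD prime for degree `6`
[cite: CastryckLaterveerOunaies2012, Thm. 4]). [cite: GrafVonBothmerEtAl2007, Prop. 6] -/
theorem holdsInDegree_six_mul_pow_of_char_239' (k : ℕ) : HoldsInDegree K (6 * 239 ^ k) := by
  haveI : Fact (Nat.Prime 239) := ⟨by norm_num⟩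
  exact holdsInDegree_mul_prime_pow_field K 239 (holdsInDegree_six_of_not_mem (K := AlgebraicClosure K) 239 (by decide)) k

set_option maxHeartbeats 1000000 in
/-- every digit `8 ≤ a < 239` fails: `¬ CA_a` over every field of characteristic `239` — the bad-prime computations of
[cite: CastryckLaterveerOunaies2012, Thm. 4] (degrees `≤ 7`) extended to every digit `8 ≤ a < 239` by explicit `𝔽_239`-rational examples and the
binomial criterion. [cite: GrafVonBothmerEtAl2007, Prop. 6] -/
theorem not_holdsInDegree_digit_of_char_twoHundredThirtyNine {a : ℕ} (h8 : 8 ≤ a) (hap : a < 239) : ¬ HoldsInDegree K a := by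
  haveI : Fact (Nat.Prime 239) := ⟨by norm_num⟩
  interval_cases a
  · exact not_holdsInDegree_eight_of_char_239 K
  · exact not_holdsInDegree_nine_of_char_239 K
  · exact not_holdsInDegree_ten_of_char_239 K
  · exact not_holdsInDegree_eleven_of_char_239 K
  · exact not_holdsInDegree_twelve_of_char_239 K
  · exact not_holdsInDegree_thirteen_of_char_239 K
  · exact not_holdsInDegree_fourteen_of_char_239 K
  · exact not_holdsInDegree_fifteen_of_char_239 K
  · exact not_holdsInDegree_sixteen_of_char_239 K
  · exact not_holdsInDegree_seventeen_of_char_239 K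
  · exact not_holdsInDegree_eighteen_of_char_239 K
  · exact not_holdsInDegree_nineteen_of_char_239 K
  · exact not_holdsInDegree_twenty_of_char_239 K
  · exact not_holdsInDegree_twentyOne_of_char_239 K
  · exact not_holdsInDegree_twentyTwo_of_char_239 K
  · exact not_holdsInDegree_twentyThree_of_char_239 K
  · exact not_holdsInDegree_twentyFour_of_char_239 K
  · exact not_holdsInDegree_of_choose_modEq_one K 239 (d := 25) (m := 6) (by norm_num) (by norm_num) (by decide)
  · exact not_holdsInDegree_twentySix_of_char_239 K
  · exact not_holdsInDegree_twentySeven_of_char_239 K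
  · exact not_holdsInDegree_twentyEight_of_char_239 K
  · exact not_holdsInDegree_twentyNine_of_char_239 K
  · exact not_holdsInDegree_thirty_of_char_239 K
  · exact not_holdsInDegree_thirtyOne_of_char_239 K
  · exact not_holdsInDegree_thirtyTwo_of_char_239 K
  · exact not_holdsInDegree_thirtyThree_of_char_239 K
  · exact not_holdsInDegree_thirtyFour_of_char_239 K
  · exact not_holdsInDegree_thirtyFive_of_char_239 K
  · exact not_holdsInDegree_thirtySix_of_char_239 K
  · exact not_holdsInDegree_thirtySeven_of_char_239 K
  · exact not_holdsInDegree_thirtyEight_of_char_239 K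
  · exact not_holdsInDegree_thirtyNine_of_char_239 K
  · exact not_holdsInDegree_forty_of_char_239 K
  · exact not_holdsInDegree_fortyOne_of_char_239 K
  · exact not_holdsInDegree_fortyTwo_of_char_239 K
  · exact not_holdsInDegree_fortyThree_of_char_239 K
  · exact not_holdsInDegree_fortyFour_of_char_239 K
  · exact not_holdsInDegree_fortyFive_of_char_239 K
  · exact not_holdsInDegree_fortySix_of_char_239 K
  · exact not_holdsInDegree_fortySeven_of_char_239 K
  · exact not_holdsInDegree_fortyEight_of_char_239 K
  · exact not_holdsInDegree_fortyNine_of_char_239 K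
  · exact not_holdsInDegree_fifty_of_char_239 K
  · exact not_holdsInDegree_fiftyOne_of_char_239 K
  · exact not_holdsInDegree_fiftyTwo_of_char_239 K
  · exact not_holdsInDegree_fiftyThree_of_char_239 K
  · exact not_holdsInDegree_fiftyFour_of_char_239 K
  · exact not_holdsInDegree_fiftyFive_of_char_239 K
  · exact not_holdsInDegree_fiftySix_of_char_239 K
  · exact not_holdsInDegree_fiftySeven_of_char_239 K
  · exact not_holdsInDegree_fiftyEight_of_char_239 K
  · exact not_holdsInDegree_fiftyNine_of_char_239 K
  · exact not_holdsInDegree_sixty_of_char_239 K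
  · exact not_holdsInDegree_sixtyOne_of_char_239 K
  · exact not_holdsInDegree_of_choose_modEq_one K 239 (d := 62) (m := 25) (by norm_num) (by norm_num) (by decide)
  · exact not_holdsInDegree_sixtyThree_of_char_239 K
  · exact not_holdsInDegree_sixtyFour_of_char_239 K
  · exact not_holdsInDegree_sixtyFive_of_char_239 K
  · exact not_holdsInDegree_of_choose_modEq_one K 239 (d := 66) (m := 5) (by norm_num) (by norm_num) (by decide)
  · exact not_holdsInDegree_sixtySeven_of_char_239 K
  · exact not_holdsInDegree_sixtyEight_of_char_239 K
  · exact not_holdsInDegree_sixtyNine_of_char_239 K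
  · exact not_holdsInDegree_seventy_of_char_239 K
  · exact not_holdsInDegree_seventyOne_of_char_239 K
  · exact not_holdsInDegree_seventyTwo_of_char_239 K
  · exact not_holdsInDegree_seventyThree_of_char_239 K
  · exact not_holdsInDegree_seventyFour_of_char_239 K
  · exact not_holdsInDegree_seventyFive_of_char_239 K
  · exact not_holdsInDegree_seventySix_of_char_239 K
  · exact not_holdsInDegree_of_choose_modEq_one K 239 (d := 77) (m := 37) (by norm_num) (by norm_num) (by decide)
  · exact not_holdsInDegree_of_choose_modEq_one K 239 (d := 78) (m := 26) (by norm_num) (by norm_num) (by decide)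
  · exact not_holdsInDegree_of_choose_modEq_one K 239 (d := 79) (m := 10) (by norm_num) (by norm_num) (by decide)
  · exact not_holdsInDegree_eighty_of_char_239 K
  · exact not_holdsInDegree_eightyOne_of_char_239 K
  · exact not_holdsInDegree_eightyTwo_of_char_239 K
  · exact not_holdsInDegree_eightyThree_of_char_239 K
  · exact not_holdsInDegree_of_choose_modEq_one K 239 (d := 84) (m := 19) (by norm_num) (by norm_num) (by decide)
  · exact not_holdsInDegree_eightyFive_of_char_239 K
  · exact not_holdsInDegree_of_choose_modEq_one K 239 (d := 86) (m := 11) (by norm_num) (by norm_num) (by decide)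
  · exact not_holdsInDegree_eightySeven_of_char_239 K
  · exact not_holdsInDegree_eightyEight_of_char_239 K
  · exact not_holdsInDegree_eightyNine_of_char_239 K
  · exact not_holdsInDegree_ninety_of_char_239 K
  · exact not_holdsInDegree_of_choose_modEq_one K 239 (d := 91) (m := 29) (by norm_num) (by norm_num) (by decide)
  · exact not_holdsInDegree_of_choose_modEq_one K 239 (d := 92) (m := 27) (by norm_num) (by norm_num) (by decide)
  · exact not_holdsInDegree_of_choose_modEq_one K 239 (d := 93) (m := 46) (by norm_num) (by norm_num) (by decide)
  · exact not_holdsInDegree_of_choose_modEq_one K 239 (d := 94) (m := 42) (by norm_num) (by norm_num) (by decide)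
  · exact not_holdsInDegree_ninetyFive_of_char_239 K
  · exact not_holdsInDegree_ninetySix_of_char_239 K
  · exact not_holdsInDegree_ninetySeven_of_char_239 K
  · exact not_holdsInDegree_of_choose_modEq_one K 239 (d := 98) (m := 28) (by norm_num) (by norm_num) (by decide)
  · exact not_holdsInDegree_of_choose_modEq_one K 239 (d := 99) (m := 20) (by norm_num) (by norm_num) (by decide)
  · exact not_holdsInDegree_of_choose_modEq_one K 239 (d := 100) (m := 25) (by norm_num) (by norm_num) (by decide)
  · exact not_holdsInDegree_oneHundredOne_of_char_239 K
  · exact not_holdsInDegree_of_choose_modEq_one K 239 (d := 102) (m := 23) (by norm_num) (by norm_num) (by decide)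
  · exact not_holdsInDegree_oneHundredThree_of_char_239 K
  · exact not_holdsInDegree_oneHundredFour_of_char_239 K
  · exact not_holdsInDegree_oneHundredFive_of_char_239 K
  · exact not_holdsInDegree_of_choose_modEq_one K 239 (d := 106) (m := 49) (by norm_num) (by norm_num) (by decide)
  · exact not_holdsInDegree_oneHundredSeven_of_char_239 K
  · exact not_holdsInDegree_oneHundredEight_of_char_239 K
  · exact not_holdsInDegree_oneHundredNine_of_char_239 K
  · exact not_holdsInDegree_oneHundredTen_of_char_239 K
  · exact not_holdsInDegree_of_choose_modEq_one K 239 (d := 111) (m := 5) (by norm_num) (by norm_num) (by decide)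
  · exact not_holdsInDegree_oneHundredTwelve_of_char_239 K
  · exact not_holdsInDegree_oneHundredThirteen_of_char_239 K
  · exact not_holdsInDegree_oneHundredFourteen_of_char_239 K
  · exact not_holdsInDegree_of_choose_modEq_one K 239 (d := 115) (m := 53) (by norm_num) (by norm_num) (by decide)
  · exact not_holdsInDegree_oneHundredSixteen_of_char_239 K
  · exact not_holdsInDegree_of_choose_modEq_one K 239 (d := 117) (m := 12) (by norm_num) (by norm_num) (by decide)
  · exact not_holdsInDegree_oneHundredEighteen_of_char_239 K
  · exact not_holdsInDegree_oneHundredNineteen_of_char_239 K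
  · exact not_holdsInDegree_of_choose_modEq_one K 239 (d := 120) (m := 51) (by norm_num) (by norm_num) (by decide)
  · exact not_holdsInDegree_oneHundredTwentyOne_of_char_239 K
  · exact not_holdsInDegree_of_choose_modEq_one K 239 (d := 122) (m := 58) (by norm_num) (by norm_num) (by decide)
  · exact not_holdsInDegree_oneHundredTwentyThree_of_char_239 K
  · exact not_holdsInDegree_oneHundredTwentyFour_of_char_239 K
  · exact not_holdsInDegree_oneHundredTwentyFive_of_char_239 K
  · exact not_holdsInDegree_oneHundredTwentySix_of_char_239 K
  · exact not_holdsInDegree_of_choose_modEq_one K 239 (d := 127) (m := 18) (by norm_num) (by norm_num) (by decide)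
  · exact not_holdsInDegree_oneHundredTwentyEight_of_char_239 K
  · exact not_holdsInDegree_of_choose_modEq_one K 239 (d := 129) (m := 18) (by norm_num) (by norm_num) (by decide)
  · exact not_holdsInDegree_oneHundredThirty_of_char_239 K
  · exact not_holdsInDegree_oneHundredThirtyOne_of_char_239 K
  · exact not_holdsInDegree_oneHundredThirtyTwo_of_char_239 K
  · exact not_holdsInDegree_of_choose_modEq_one K 239 (d := 133) (m := 12) (by norm_num) (by norm_num) (by decide)
  · exact not_holdsInDegree_oneHundredThirtyFour_of_char_239 K
  · exact not_holdsInDegree_oneHundredThirtyFive_of_char_239 K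
  · exact not_holdsInDegree_oneHundredThirtySix_of_char_239 K
  · exact not_holdsInDegree_of_choose_modEq_one K 239 (d := 137) (m := 51) (by norm_num) (by norm_num) (by decide)
  · exact not_holdsInDegree_oneHundredThirtyEight_of_char_239 K
  · exact not_holdsInDegree_oneHundredThirtyNine_of_char_239 K
  · exact not_holdsInDegree_oneHundredForty_of_char_239 K
  · exact not_holdsInDegree_oneHundredFortyOne_of_char_239 K
  · exact not_holdsInDegree_oneHundredFortyTwo_of_char_239 K
  · exact not_holdsInDegree_oneHundredFortyThree_of_char_239 K
  · exact not_holdsInDegree_oneHundredFortyFour_of_char_239 K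
  · exact not_holdsInDegree_oneHundredFortyFive_of_char_239 K
  · exact not_holdsInDegree_of_choose_modEq_one K 239 (d := 146) (m := 64) (by norm_num) (by norm_num) (by decide)
  · exact not_holdsInDegree_oneHundredFortySeven_of_char_239 K
  · exact not_holdsInDegree_of_choose_modEq_one K 239 (d := 148) (m := 60) (by norm_num) (by norm_num) (by decide)
  · exact not_holdsInDegree_oneHundredFortyNine_of_char_239 K
  · exact not_holdsInDegree_of_choose_modEq_one K 239 (d := 150) (m := 7) (by norm_num) (by norm_num) (by decide)
  · exact not_holdsInDegree_oneHundredFiftyOne_of_char_239 K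
  · exact not_holdsInDegree_oneHundredFiftyTwo_of_char_239 K
  · exact not_holdsInDegree_oneHundredFiftyThree_of_char_239 K
  · exact not_holdsInDegree_oneHundredFiftyFour_of_char_239 K
  · exact not_holdsInDegree_of_choose_modEq_one K 239 (d := 155) (m := 59) (by norm_num) (by norm_num) (by decide)
  · exact not_holdsInDegree_of_choose_modEq_one K 239 (d := 156) (m := 64) (by norm_num) (by norm_num) (by decide)
  · exact not_holdsInDegree_oneHundredFiftySeven_of_char_239 K
  · exact not_holdsInDegree_of_choose_modEq_one K 239 (d := 158) (m := 78) (by norm_num) (by norm_num) (by decide)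
  · exact not_holdsInDegree_of_choose_modEq_one K 239 (d := 159) (m := 20) (by norm_num) (by norm_num) (by decide)
  · exact not_holdsInDegree_of_choose_modEq_one K 239 (d := 160) (m := 75) (by norm_num) (by norm_num) (by decide)
  · exact not_holdsInDegree_oneHundredSixtyOne_of_char_239 K
  · exact not_holdsInDegree_oneHundredSixtyTwo_of_char_239 K
  · exact not_holdsInDegree_oneHundredSixtyThree_of_char_239 K
  · exact not_holdsInDegree_oneHundredSixtyFour_of_char_239 K
  · exact not_holdsInDegree_oneHundredSixtyFive_of_char_239 K
  · exact not_holdsInDegree_oneHundredSixtySix_of_char_239 K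
  · exact not_holdsInDegree_oneHundredSixtySeven_of_char_239 K
  · exact not_holdsInDegree_of_choose_modEq_one K 239 (d := 168) (m := 21) (by norm_num) (by norm_num) (by decide)
  · exact not_holdsInDegree_of_choose_modEq_one K 239 (d := 169) (m := 10) (by norm_num) (by norm_num) (by decide)
  · exact not_holdsInDegree_oneHundredSeventy_of_char_239 K
  · exact not_holdsInDegree_oneHundredSeventyOne_of_char_239 K
  · exact not_holdsInDegree_of_choose_modEq_one K 239 (d := 172) (m := 85) (by norm_num) (by norm_num) (by decide)
  · exact not_holdsInDegree_oneHundredSeventyThree_of_char_239 K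
  · exact not_holdsInDegree_of_choose_modEq_one K 239 (d := 174) (m := 58) (by norm_num) (by norm_num) (by decide)
  · exact not_holdsInDegree_oneHundredSeventyFive_of_char_239 K
  · exact not_holdsInDegree_oneHundredSeventySix_of_char_239 K
  · exact not_holdsInDegree_oneHundredSeventySeven_of_char_239 K
  · exact not_holdsInDegree_of_choose_modEq_one K 239 (d := 178) (m := 88) (by norm_num) (by norm_num) (by decide)
  · exact not_holdsInDegree_of_choose_modEq_one K 239 (d := 179) (m := 83) (by norm_num) (by norm_num) (by decide)
  · exact not_holdsInDegree_of_choose_modEq_one K 239 (d := 180) (m := 64) (by norm_num) (by norm_num) (by decide)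
  · exact not_holdsInDegree_oneHundredEightyOne_of_char_239 K
  · exact not_holdsInDegree_oneHundredEightyTwo_of_char_239 K
  · exact not_holdsInDegree_oneHundredEightyThree_of_char_239 K
  · exact not_holdsInDegree_oneHundredEightyFour_of_char_239 K
  · exact not_holdsInDegree_of_choose_modEq_one K 239 (d := 185) (m := 62) (by norm_num) (by norm_num) (by decide)
  · exact not_holdsInDegree_of_choose_modEq_one K 239 (d := 186) (m := 26) (by norm_num) (by norm_num) (by decide)
  · exact not_holdsInDegree_of_choose_modEq_one K 239 (d := 187) (m := 86) (by norm_num) (by norm_num) (by decide)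
  · exact not_holdsInDegree_oneHundredEightyEight_of_char_239 K
  · exact not_holdsInDegree_oneHundredEightyNine_of_char_239 K
  · exact not_holdsInDegree_oneHundredNinety_of_char_239 K
  · exact not_holdsInDegree_of_choose_modEq_one K 239 (d := 191) (m := 46) (by norm_num) (by norm_num) (by decide)
  · exact not_holdsInDegree_oneHundredNinetyTwo_of_char_239 K
  · exact not_holdsInDegree_of_choose_modEq_one K 239 (d := 193) (m := 43) (by norm_num) (by norm_num) (by decide)
  · exact not_holdsInDegree_oneHundredNinetyFour_of_char_239 K
  · exact not_holdsInDegree_of_choose_modEq_one K 239 (d := 195) (m := 45) (by norm_num) (by norm_num) (by decide)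
  · exact not_holdsInDegree_of_choose_modEq_one K 239 (d := 196) (m := 52) (by norm_num) (by norm_num) (by decide)
  · exact not_holdsInDegree_oneHundredNinetySeven_of_char_239 K
  · exact not_holdsInDegree_oneHundredNinetyEight_of_char_239 K
  · exact not_holdsInDegree_oneHundredNinetyNine_of_char_239 K
  · exact not_holdsInDegree_twoHundred_of_char_239 K
  · exact not_holdsInDegree_of_choose_modEq_one K 239 (d := 201) (m := 40) (by norm_num) (by norm_num) (by decide)
  · exact not_holdsInDegree_twoHundredTwo_of_char_239 K
  · exact not_holdsInDegree_twoHundredThree_of_char_239 K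
  · exact not_holdsInDegree_twoHundredFour_of_char_239 K
  · exact not_holdsInDegree_twoHundredFive_of_char_239 K
  · exact not_holdsInDegree_of_choose_modEq_one K 239 (d := 206) (m := 52) (by norm_num) (by norm_num) (by decide)
  · exact not_holdsInDegree_twoHundredSeven_of_char_239 K
  · exact not_holdsInDegree_twoHundredEight_of_char_239 K
  · exact not_holdsInDegree_of_choose_modEq_one K 239 (d := 209) (m := 62) (by norm_num) (by norm_num) (by decide)
  · exact not_holdsInDegree_of_choose_modEq_one K 239 (d := 210) (m := 70) (by norm_num) (by norm_num) (by decide)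
  · exact not_holdsInDegree_twoHundredEleven_of_char_239 K
  · exact not_holdsInDegree_of_choose_modEq_one K 239 (d := 212) (m := 52) (by norm_num) (by norm_num) (by decide)
  · exact not_holdsInDegree_twoHundredThirteen_of_char_239 K
  · exact not_holdsInDegree_twoHundredFourteen_of_char_239 K
  · exact not_holdsInDegree_of_choose_modEq_one K 239 (d := 215) (m := 9) (by norm_num) (by norm_num) (by decide)
  · exact not_holdsInDegree_twoHundredSixteen_of_char_239 K
  · exact not_holdsInDegree_of_choose_modEq_one K 239 (d := 217) (m := 96) (by norm_num) (by norm_num) (by decide)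
  · exact not_holdsInDegree_twoHundredEighteen_of_char_239 K
  · exact not_holdsInDegree_of_choose_modEq_one K 239 (d := 219) (m := 6) (by norm_num) (by norm_num) (by decide)
  · exact not_holdsInDegree_twoHundredTwenty_of_char_239 K
  · exact not_holdsInDegree_twoHundredTwentyOne_of_char_239 K
  · exact not_holdsInDegree_of_choose_modEq_one K 239 (d := 222) (m := 53) (by norm_num) (by norm_num) (by decide)
  · exact not_holdsInDegree_twoHundredTwentyThree_of_char_239 K
  · exact not_holdsInDegree_twoHundredTwentyFour_of_char_239 K
  · exact not_holdsInDegree_twoHundredTwentyFive_of_char_239 K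
  · exact not_holdsInDegree_twoHundredTwentySix_of_char_239 K
  · exact not_holdsInDegree_twoHundredTwentySeven_of_char_239 K
  · exact not_holdsInDegree_twoHundredTwentyEight_of_char_239 K
  · exact not_holdsInDegree_of_choose_modEq_one K 239 (d := 229) (m := 23) (by norm_num) (by norm_num) (by decide)
  · exact not_holdsInDegree_twoHundredThirty_of_char_239 K
  · exact not_holdsInDegree_twoHundredThirtyOne_of_char_239 K
  · exact not_holdsInDegree_of_choose_modEq_one K 239 (d := 232) (m := 53) (by norm_num) (by norm_num) (by decide)
  · exact not_holdsInDegree_of_choose_modEq_one K 239 (d := 233) (m := 106) (by norm_num) (by norm_num) (by decide)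
  · exact not_holdsInDegree_twoHundredThirtyFour_of_char_239 K
  · exact not_holdsInDegree_twoHundredThirtyFive_of_char_239 K
  · exact not_holdsInDegree_of_choose_modEq_one K 239 (d := 236) (m := 71) (by norm_num) (by norm_num) (by decide)
  · exact not_holdsInDegree_twoHundredThirtySeven_of_char_239 K
  · exact not_holdsInDegree_of_choose_modEq_one K 239 (d := 238) (m := 2) (by norm_num) (by norm_num) (by decide)

/-- the positive digits `1 ≤ a ≤ 5`: `CA_{a·239^k}` over every field of characteristic `239`. [cite: GrafVonBothmerEtAl2007, Props. 2, 6]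
[cite: CastryckLaterveerOunaies2012, Thm. 4] -/
theorem holdsInDegree_mul_twoHundredThirtyNine_pow_of_le_five {a : ℕ} (ha0 : 0 < a) (ha5 : a ≤ 5) (k : ℕ) :
    HoldsInDegree K (a * 239 ^ k) := by
  haveI : Fact (Nat.Prime 239) := ⟨by norm_num⟩
  interval_cases a
  · simpa using holdsInDegree_prime_pow_field K 239 k
  · exact holdsInDegree_two_mul_prime_pow_field K 239 k
  · exact holdsInDegree_three_mul_prime_pow_field K 239 (by norm_num) k
  · exact holdsInDegree_mul_prime_pow_field K 239
      (holdsInDegree_of_le_four_of_charP (AlgebraicClosure K) 239 (by norm_num) le_rfl) k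
  · exact holdsInDegree_five_mul_prime_pow_field K 239 (by norm_num) (by norm_num) (by norm_num) (by norm_num)
      (by norm_num) (by norm_num) (by norm_num) (by norm_num) (by norm_num) k

/-- **characteristic 239, complete**: over every field of characteristic `239`,
`CA_d ⟺ d = 0 ∨ d = a·239^k` with `1 ≤ a ≤ 7`. [cite: GrafVonBothmerEtAl2007, Props. 2, 6, 7]
[cite: CastryckLaterveerOunaies2012, Thm. 4] -/
theorem classification_char_twoHundredThirtyNine_complete (d : ℕ) :
    HoldsInDegree K d ↔ d = 0 ∨ ∃ k a : ℕ, 0 < a ∧ a ≤ 7 ∧ d = a * 239 ^ k := by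
  haveI : Fact (Nat.Prime 239) := ⟨by norm_num⟩
  constructor
  · intro h
    rcases Nat.eq_zero_or_pos d with rfl | hd
    · exact Or.inl rfl
    obtain ⟨k, a, ha0, hap, rfl, ha⟩ := digit_of_holdsInDegree K 239 hd.ne' h
    refine Or.inr ⟨k, a, ha0, ?_, rfl⟩
    by_contra h7
    exact not_holdsInDegree_digit_of_char_twoHundredThirtyNine K (by omega) hap ha
  · rintro (rfl | ⟨k, a, ha0, ha7, rfl⟩)
    · exact holdsInDegree_zero K
    · rcases Nat.lt_or_ge a 6 with ha | ha
      · exact holdsInDegree_mul_twoHundredThirtyNine_pow_of_le_five K ha0 (by omega) k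
      · rcases Nat.lt_or_ge a 7 with ha' | ha'
        · obtain rfl : a = 6 := by omega
          exact holdsInDegree_six_mul_pow_of_char_239' K k
        · obtain rfl : a = 7 := le_antisymm ha7 ha'
          exact holdsInDegree_seven_mul_pow_of_char_239 (K := K) k

/-- the set of Casas-Alvero degrees `≤ 57121` in characteristic `239`, explicitly (corollary of the classification:
[cite: GrafVonBothmerEtAl2007, Prop. 6] with [cite: CastryckLaterveerOunaies2012, Thm. 4] and the digit refutations above). -/
theorem holdsInDegree_iff_mem_of_le_char_twoHundredThirtyNine_sq {d : ℕ} (hd : d ≤ 57121) :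
    HoldsInDegree K d ↔ d ∈ ({0, 1, 2, 3, 4, 5, 6, 7, 239, 478, 717, 956, 1195, 1434, 1673, 57121} : Finset ℕ) := by
  rw [classification_char_twoHundredThirtyNine_complete]
  constructor
  · rintro (rfl | ⟨k, a, ha0, ha7, rfl⟩)
    · decide
    · rcases k with _ | _ | _ | k
      · interval_cases a <;> decide
      · interval_cases a <;> decide
      · interval_cases a <;> simp_all
      · exfalso
        have : 239 ^ 3 ≤ a * 239 ^ (k + 1 + 1 + 1) :=
          le_trans (Nat.pow_le_pow_right (by norm_num) (by omega)) (Nat.le_mul_of_pos_left _ ha0)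
        omega
  · intro h
    simp only [Finset.mem_insert, Finset.mem_singleton] at h
    rcases h with rfl | rfl | rfl | rfl | rfl | rfl | rfl | rfl | rfl | rfl | rfl | rfl | rfl | rfl | rfl | rfl
    · exact Or.inl rfl
    · exact Or.inr ⟨0, 1, by norm_num, by norm_num, by norm_num⟩
    · exact Or.inr ⟨0, 2, by norm_num, by norm_num, by norm_num⟩
    · exact Or.inr ⟨0, 3, by norm_num, by norm_num, by norm_num⟩
    · exact Or.inr ⟨0, 4, by norm_num, by norm_num, by norm_num⟩
    · exact Or.inr ⟨0, 5, by norm_num, by norm_num, by norm_num⟩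
    · exact Or.inr ⟨0, 6, by norm_num, by norm_num, by norm_num⟩
    · exact Or.inr ⟨0, 7, by norm_num, by norm_num, by norm_num⟩
    · exact Or.inr ⟨1, 1, by norm_num, by norm_num, by norm_num⟩
    · exact Or.inr ⟨1, 2, by norm_num, by norm_num, by norm_num⟩
    · exact Or.inr ⟨1, 3, by norm_num, by norm_num, by norm_num⟩
    · exact Or.inr ⟨1, 4, by norm_num, by norm_num, by norm_num⟩
    · exact Or.inr ⟨1, 5, by norm_num, by norm_num, by norm_num⟩
    · exact Or.inr ⟨1, 6, by norm_num, by norm_num, by norm_num⟩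
    · exact Or.inr ⟨1, 7, by norm_num, by norm_num, by norm_num⟩
    · exact Or.inr ⟨2, 1, by norm_num, by norm_num, by norm_num⟩

end CharTwoHundredThirtyNine

end Literature.Algebra.Polynomial.CasasAlvero
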